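import Summits.CriticalPhenomena.CardyFormulaZ2.Theorems.CardyUSTContinuationKirchhoffExtremalLengthG02Dual2

/-!
# Flux-free steps across the exterior, exits of the face component, bounded currents
# ([GP19] §3.1–3.2 for the `meshDomain` / `discreteArc` discretisation)

Support file for `KirchhoffExtremalLength` (route CardyUSTContinuation of `CardyFormulaZ2`, item
stmt-CriticalPhenomena-11234), towards the upper half of `G02ModulusConvergence` (`…Defs.lean`).
Transposition of parts of §D3/§D5/§D6 of the tree's `SquareTilingConjugate.lean` to
`Ω_δ = discreteDomainGraph Ω δ`:

* a step of a walk of squares crossing a side that contains an EXTERIOR point carries no current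
  (`stepFlux_eq_zero_of_mem_sideSeg'`, `walkFlux_eq_zero_of_sideSeg'`) — for this discretisation
  (closed mesh edges in `Ω̄`) boundary points do not suffice, exterior points do;
* a square with sides in `Ω` and a corner in `Ω_δ` is an inner face (`isInnerFace_of_sides_subset`),
  so **the outer square of an exit meets `∂Ω`** (`exists_mem_frontier_of_adj_not_isInnerFace`);
* currents and step fluxes of `[0,1]`-valued potentials are bounded by `1`.
-/

noncomputable section

namespace Summit.CriticalPhenomena.CardyFormulaZ2.Theorems

namespace KirchhoffSlope

open Set Metric Filter Topology SimpleGraph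
open Literature.Probability Literature.Probability.LatticeModels Literature.Probability.Percolation
open Literature.Probability.LatticeModels.SquareTiling (stepFlux walkFlux walkFlux_cons closedSq
  convex_closedSq meshPoint_mem_closedSq sideSeg side_subset_closedSq)
open Literature.Probability.RandomPlanarGeometry

variable {Ω : Set ℂ} {δ : ℝ}

/-! ### Flux-free steps -/

/-- A step of a walk of squares whose crossed side contains an exterior point (a point outside
`Ω̄`) carries no current: the crossed primal edge is not a mesh edge. [folklore] -/
theorem stepFlux_eq_zero_of_mem_sideSeg' (h : Site 2 → ℝ) {x y : Site 2} (hxy : (zdGraph 2).Adj x y)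
    {w : ℂ} (hw : w ∈ sideSeg δ x y) (hwΩ : w ∉ closure Ω) :
    stepFlux (ecurH Ω δ h) (ecurV Ω δ h) x y = 0 := by
  -- the crossed primal edge is not an edge of `Ω_n`
  have key : ∀ a b : Site 2, sideSeg δ x y = segment ℝ (meshPoint δ a) (meshPoint δ b) →
      ecur Ω δ h a b = 0 := by
    intro a b hab
    refine ecur_of_not_adj fun hadj => hwΩ ?_
    have hseg := (meshGraph_adj_iff.1 (discreteDomainGraph_adj_iff.1 hadj).1).2
    exact hseg (by rw [← hab]; exact hw)
  rcases stepKind_of_adj hxy with ⟨h0, h1⟩ | ⟨h0, h1⟩ | ⟨h1, h0⟩ | ⟨h1, h0⟩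
  · -- right step: crosses the right side of `x`, the vertical edge from `x + e₀`
    have hy : y = x + Pi.single 0 1 := by simp [Site.eq_iff_two, h0, h1]
    subst hy
    have hval : stepFlux (ecurH Ω δ h) (ecurV Ω δ h) x (x + Pi.single 0 1) = -ecurV Ω δ h (x - Pi.single 1 1) := by
      unfold stepFlux
      have c0 : (x + Pi.single 0 1 : Site 2) 0 = x 0 + 1 := by simp
      have c1 : (x + Pi.single 0 1 : Site 2) 1 = x 1 := by simp
      simp [c0, c1]
    rw [hval, ecurV, key]
    · simp
    · rw [sideSeg, sepLo_add_e0, sepHi_add_e0]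
      congr 2 <;> ext i <;> fin_cases i <;> simp
  · have hx : x = y + Pi.single 0 1 := by simp [Site.eq_iff_two, h0, h1]
    subst hx
    have hval : stepFlux (ecurH Ω δ h) (ecurV Ω δ h) (y + Pi.single 0 1) y = ecurV Ω δ h (y - Pi.single 1 1) := by
      unfold stepFlux
      have c0 : (y + Pi.single 0 1 : Site 2) 0 = y 0 + 1 := by simp
      have c1 : (y + Pi.single 0 1 : Site 2) 1 = y 1 := by simp
      simp [c0, c1]
      omega
    rw [hval, ecurV, key]
    rw [sideSeg, sepLo_comm, sepHi_comm, sepLo_add_e0, sepHi_add_e0]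
    congr 2 <;> ext i <;> fin_cases i <;> simp
  · have hy : y = x + Pi.single 1 1 := by simp [Site.eq_iff_two, h0, h1]
    subst hy
    have hval : stepFlux (ecurH Ω δ h) (ecurV Ω δ h) x (x + Pi.single 1 1) = ecurH Ω δ h (x - Pi.single 0 1) := by
      unfold stepFlux
      have c0 : (x + Pi.single 1 1 : Site 2) 0 = x 0 := by simp
      have c1 : (x + Pi.single 1 1 : Site 2) 1 = x 1 + 1 := by simp
      simp [c0, c1]
    rw [hval, ecurH, key]
    rw [sideSeg, sepLo_add_e1, sepHi_add_e1]
    congr 2 <;> ext i <;> fin_cases i <;> simp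
  · have hx : x = y + Pi.single 1 1 := by simp [Site.eq_iff_two, h0, h1]
    subst hx
    have hval : stepFlux (ecurH Ω δ h) (ecurV Ω δ h) (y + Pi.single 1 1) y = -ecurH Ω δ h (y - Pi.single 0 1) := by
      unfold stepFlux
      have c0 : (y + Pi.single 1 1 : Site 2) 0 = y 0 := by simp
      have c1 : (y + Pi.single 1 1 : Site 2) 1 = y 1 + 1 := by simp
      simp [c0, c1]
      omega
    rw [hval, ecurH, key]
    · simp
    · rw [sideSeg, sepLo_comm, sepHi_comm, sepLo_add_e1, sepHi_add_e1]
      congr 2 <;> ext i <;> fin_cases i <;> simp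

/-- A walk of squares all of whose steps cross sides containing exterior points carries no
flux. [folklore] -/
theorem walkFlux_eq_zero_of_sideSeg' (h : Site 2 → ℝ) {a b : Site 2} (ω : (zdGraph 2).Walk a b)
    (hω : ∀ d ∈ ω.darts, ∃ w ∈ sideSeg δ d.fst d.snd, w ∉ closure Ω) :
    walkFlux (ecurH Ω δ h) (ecurV Ω δ h) ω = 0 := by
  induction ω with
  | nil => rfl
  | cons hxy p ih =>
    rw [walkFlux_cons, ih fun d hd => hω d (by simp [hd]), add_zero]
    obtain ⟨w, hw, hwΩ⟩ := hω ⟨(_, _), hxy⟩ (by simp)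
    exact stepFlux_eq_zero_of_mem_sideSeg' h hxy hw hwΩ


/-! ### Exits and bounded currents -/

/-- A square all of whose sides lie in `Ω` and one of whose corners is a vertex of `Ω_δ` is an
inner face. [folklore] -/
theorem isInnerFace_of_sides_subset {p : Site 2}
    (hB : segment ℝ (meshPoint δ p) (meshPoint δ (p + Pi.single 0 1)) ⊆ Ω)
    (hT : segment ℝ (meshPoint δ (p + Pi.single 1 1)) (meshPoint δ (p + Pi.single 1 1 + Pi.single 0 1)) ⊆ Ω)
    (hL : segment ℝ (meshPoint δ p) (meshPoint δ (p + Pi.single 1 1)) ⊆ Ω)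
    (hR : segment ℝ (meshPoint δ (p + Pi.single 0 1)) (meshPoint δ (p + Pi.single 0 1 + Pi.single 1 1)) ⊆ Ω)
    (hc : p ∈ meshDomain Ω δ ∨ p + Pi.single 0 1 ∈ meshDomain Ω δ ∨ p + Pi.single 1 1 ∈ meshDomain Ω δ ∨
      p + Pi.single 0 1 + Pi.single 1 1 ∈ meshDomain Ω δ) : IsInnerFace Ω δ p := by
  have aB : (meshGraph Ω δ).Adj p (p + Pi.single 0 1) :=
    meshGraph_adj_iff.2 ⟨adj_of_stepKind (.right (by simp) (by simp)), hB.trans subset_closure⟩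
  have aT : (meshGraph Ω δ).Adj (p + Pi.single 1 1) (p + Pi.single 1 1 + Pi.single 0 1) :=
    meshGraph_adj_iff.2 ⟨adj_of_stepKind (.right (by simp) (by simp)), hT.trans subset_closure⟩
  have aL : (meshGraph Ω δ).Adj p (p + Pi.single 1 1) :=
    meshGraph_adj_iff.2 ⟨adj_of_stepKind (.up (by simp) (by simp)), hL.trans subset_closure⟩
  have aR : (meshGraph Ω δ).Adj (p + Pi.single 0 1) (p + Pi.single 0 1 + Pi.single 1 1) :=
    meshGraph_adj_iff.2 ⟨adj_of_stepKind (.up (by simp) (by simp)), hR.trans subset_closure⟩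
  have e : p + Pi.single 1 1 + Pi.single 0 1 = p + Pi.single 0 1 + Pi.single 1 1 := by abel
  rw [e] at aT hT
  -- the mesh points of the four corners lie in `Ω`
  have mp : p ∈ meshVertices Ω δ := hB (left_mem_segment ℝ _ _)
  have m0 : p + Pi.single 0 1 ∈ meshVertices Ω δ := hB (right_mem_segment ℝ _ _)
  have m1 : p + Pi.single 1 1 ∈ meshVertices Ω δ := hL (right_mem_segment ℝ _ _)
  have m01 : p + Pi.single 0 1 + Pi.single 1 1 ∈ meshVertices Ω δ := hR (right_mem_segment ℝ _ _)
  -- all four corners are vertices of `Ω_δ`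
  have hp : p ∈ meshDomain Ω δ := by
    rcases hc with h | h | h | h
    · exact h
    · exact mem_meshDomain_of_meshGraph_adj h mp aB.symm
    · exact mem_meshDomain_of_meshGraph_adj h mp aL.symm
    · exact mem_meshDomain_of_meshGraph_adj (mem_meshDomain_of_meshGraph_adj h m0 aR.symm) mp aB.symm
  have h1 := mem_meshDomain_of_meshGraph_adj hp m0 aB
  have h2 := mem_meshDomain_of_meshGraph_adj hp m1 aL
  have h3 := mem_meshDomain_of_meshGraph_adj h1 m01 aR
  refine ⟨discreteDomainGraph_adj_iff.2 ⟨aB, hp, h1⟩, ?_, discreteDomainGraph_adj_iff.2 ⟨aL, hp, h2⟩, discreteDomainGraph_adj_iff.2 ⟨aR, h1, h3⟩⟩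
  rw [e]
  exact discreteDomainGraph_adj_iff.2 ⟨aT, h2, h3⟩

/-- **The outer square of an exit meets the boundary curve.** If `p` is inner and its lattice
neighbour `p'` is not, the closed square `p'` contains a point of `∂Ω` (it contains the common
side, inside `Ω`, and is not contained in `Ω`). [folklore] -/
theorem exists_mem_frontier_of_adj_not_isInnerFace (R : ConformalRectangle) (hδ : 0 < δ)
    {p p' : Site 2} (hp : IsInnerFace R.carrier δ p) (hpp' : (zdGraph 2).Adj p p') (hp' : ¬ IsInnerFace R.carrier δ p') :
    ∃ j ∈ closedSq δ p', j ∈ frontier R.carrier := by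
  -- a point of `Ω` in the closed square `p'`: the corner `p ⊔ p'` (a vertex of `Ω_n`)
  have hcorner : p ⊔ p' ∈ meshDomain R.carrier δ ∧ meshPoint δ (p ⊔ p') ∈ closedSq δ p' ∧
      meshPoint δ (p ⊔ p') ∈ R.carrier := by
    suffices hsuf : p ⊔ p' ∈ meshDomain R.carrier δ ∧ meshPoint δ (p ⊔ p') ∈ closedSq δ p' from
      ⟨hsuf.1, hsuf.2, meshDomain_subset_meshVertices _ _ hsuf.1⟩
    obtain ⟨aB, aT, aL, aR⟩ := hp
    rcases stepKind_of_adj hpp' with ⟨h0, h1⟩ | ⟨h0, h1⟩ | ⟨h1, h0⟩ | ⟨h1, h0⟩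
    · have e : p ⊔ p' = p + Pi.single 0 1 := by ext i; fin_cases i <;> simp <;> omega
      rw [e]
      exact ⟨(discreteDomainGraph_adj_iff.1 aB).2.2, meshPoint_mem_closedSq hδ.le (Or.inl (by simp [h0])) (Or.inl (by simp [h1]))⟩
    · have e : p ⊔ p' = p := by ext i; fin_cases i <;> simp <;> omega
      rw [e]
      exact ⟨(discreteDomainGraph_adj_iff.1 aB).2.1, meshPoint_mem_closedSq hδ.le (Or.inr h0) (Or.inl h1.symm)⟩
    · have e : p ⊔ p' = p + Pi.single 1 1 := by ext i; fin_cases i <;> simp <;> omega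
      rw [e]
      exact ⟨(discreteDomainGraph_adj_iff.1 aL).2.2, meshPoint_mem_closedSq hδ.le (Or.inl (by simp [h0])) (Or.inl (by simp [h1]))⟩
    · have e : p ⊔ p' = p := by ext i; fin_cases i <;> simp <;> omega
      rw [e]
      exact ⟨(discreteDomainGraph_adj_iff.1 aL).2.1, meshPoint_mem_closedSq hδ.le (Or.inl h0.symm) (Or.inr h1)⟩
  have h1 : (closedSq δ p' ∩ R.carrier).Nonempty := ⟨_, hcorner.2.1, hcorner.2.2⟩
  -- a point of the closed square outside `Ω`
  have h2 : (closedSq δ p' ∩ R.carrierᶜ).Nonempty := by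
    by_contra hne
    rw [not_nonempty_iff_eq_empty] at hne
    have hne : closedSq δ p' ⊆ R.carrier := fun z hz => by
      by_contra hz'
      have : z ∈ closedSq δ p' ∩ R.carrierᶜ := ⟨hz, hz'⟩
      rw [hne] at this
      exact this.elim
    refine hp' (isInnerFace_of_sides_subset ?_ ?_ ?_ ?_ ?_)
    · exact (side_subset_closedSq hδ.le ⟨Or.inl rfl, Or.inl rfl⟩ ⟨Or.inr (by simp), Or.inl (by simp)⟩).trans hne
    · exact (side_subset_closedSq hδ.le ⟨Or.inl (by simp), Or.inr (by simp)⟩ ⟨Or.inr (by simp), Or.inr (by simp)⟩).trans hne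
    · exact (side_subset_closedSq hδ.le ⟨Or.inl rfl, Or.inl rfl⟩ ⟨Or.inl (by simp), Or.inr (by simp)⟩).trans hne
    · exact (side_subset_closedSq hδ.le ⟨Or.inr (by simp), Or.inl (by simp)⟩ ⟨Or.inr (by simp), Or.inr (by simp)⟩).trans hne
    · -- the corner `p ⊔ p'` of `p'` is a vertex of `Ω_n`
      rcases stepKind_of_adj hpp' with ⟨h0, h1⟩ | ⟨h0, h1⟩ | ⟨h1, h0⟩ | ⟨h1, h0⟩
      · left; convert hcorner.1 using 1; ext i; fin_cases i <;> simp <;> omega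
      · right; left; convert hcorner.1 using 1; ext i; fin_cases i <;> simp <;> omega
      · left; convert hcorner.1 using 1; ext i; fin_cases i <;> simp <;> omega
      · right; right; left; convert hcorner.1 using 1; ext i; fin_cases i <;> simp <;> omega
  obtain ⟨j, hj, hjf⟩ := (convex_closedSq δ p').isPreconnected.inter_frontier_nonempty' h1 h2
  exact ⟨j, hj, hjf⟩

/-- Currents of a `[0,1]`-valued potential are at most `1` in absolute value. [folklore] -/
theorem abs_ecur_le_one {h : Site 2 → ℝ} (h01 : ∀ x, h x ∈ Icc (0 : ℝ) 1) (x y : Site 2) : |ecur Ω δ h x y| ≤ 1 := by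
  unfold ecur
  split_ifs
  · have := h01 x; have := h01 y
    simp only [mem_Icc] at *
    rw [abs_le]; constructor <;> linarith
  · simp

/-- Step fluxes of a `[0,1]`-valued potential are at most `1` in absolute value. [folklore] -/
theorem abs_stepFlux_le_one' {h : Site 2 → ℝ} (h01 : ∀ x, h x ∈ Icc (0 : ℝ) 1) (x y : Site 2) :
    |stepFlux (ecurH Ω δ h) (ecurV Ω δ h) x y| ≤ 1 := by
  unfold stepFlux ecurH ecurV
  split_ifs <;> first | exact abs_ecur_le_one h01 _ _ | (rw [abs_neg]; exact abs_ecur_le_one h01 _ _) | simp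


end KirchhoffSlope

end Summit.CriticalPhenomena.CardyFormulaZ2.Theorems
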